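import Summits.QuantumAdvantage.QuantumAdvantage.Theorems.SosSandwichPseudoBoundedMultiplierBound
import Literature.Computability.QuantumComplexity.InfluenceBounds
import Literature.Computability.Complexity.FourierDegreeAlgebra
import Literature.Computability.Complexity.FourierTails
import Literature.Computability.Complexity.BonamiLevelK
import Literature.Computability.QuantumComplexity.PseudoBounded
import HarnessLib

/-!
# Route `SosSandwich`, support `HomogeneousPBAAT` (stmt-27399) / crux `PseudoBoundedAA` (stmt-15237) — the top-homogeneous class in Fourier terms, and the HOMOGENEOUS multiplier reduction

Tools for the T-lossy homogeneous rung (`--supports stmt-QuantumAdvantage-15237 --as helper`):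

§1 `cubeFourierCoeff_laplacian`, `cubeFourierCoeff_eq_zero_of_laplacian` — the route's homogeneity hypothesis
(Laplacian eigen-equation `Σᵢ (p(x) − p(x ⊕ eᵢ)) = 4T (p(x) − E p)`, the antecedent of `HomogeneousPBAAT`)
in Fourier language: `p̂(S) = 0` for every `S` with `|S| ∉ {0, 2T}` — the centred part of `p` lives on Walsh
level exactly `2T` (because the Laplacian multiplies `χ_S` by `2|S|`).

§2 `boolAvg_sq_mul_eq_top`, `boolAvg_top_sq_le` — the HOMOGENEOUS MULTIPLIER REDUCTION: if `h = p − E p` lives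
on level `2T` and `q` has total degree `≤ T`, then `E[q² h] = E[a² h]` and `E[a²] ≤ E[q²]`, where
`a = Σ_{|S| = T} q̂(S) χ_S` is the top (level-`T`) Walsh part of `q` (`q² − a² = b(2a + b)` with `b` the part
below level `T` has Fourier degree `≤ 2T − 1`, hence is orthogonal to `h`).  Consequently the degree-`T`
SOS-multiplier norm of `h` (file `SosSandwichPseudoBoundedMultiplierBound`) is attained on HOMOGENEOUS degree-`T`
Walsh sums, and

§3 `boolVariance_le_of_homogeneous_multiplier` — for top-homogeneous `p ∈ K_T`: if `|E[a² (p − E p)]| ≤ κ E[a²]`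
for every homogeneous level-`T` Walsh sum `a = Σ_{|S|=T} c_S χ_S`, then `Var[p] ≤ κ · min(E p, 1 − E p) ≤ κ/2`
(on the address family `a = (G+G')/2` gives ratio exactly `1/2 = 2 Var`, so `Var ≤ κ/2` is attained).
CAVEAT (calibration, so that nobody is misled): the NAIVE influence-only estimate "`κ ≤ C·√(T·maxInf)` for the
tilt by `p − E p` itself" — which would give `maxInf ≥ Var²/(C'T)` — is FALSE already at `T = 1`: for the
symmetric quadratic `h = ε Σ_{i<k} xᵢxₖ` (in `K_1` after centring for `ε ≲ 1/N²`) the homogeneous multiplier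
ratio is `ε(N−1)` (test sum `a = Σᵢ xᵢ`) while `maxInf = 4ε²(N−1)`, ratio `κ/√maxInf = √(N−1)/2 → ∞`; the
T = 1 theorem `OneQueryFrameAA` nevertheless holds (there `Var²/maxInf → 0`).  So a proof of the rung through
pseudo-expectation tilts must tilt by test functions `g` OTHER than `p − E p` (the general lemma
`abs_boolAvg_mul_le_mul_boolAvg` of `SosSandwichPseudoBoundedMultiplierBound` allows any mean-zero `g`), or
bound `κ` using more than the influences.  Honest label: reformulation/tooling; no estimate of `κ` is proved.

Sources: ODonnell2014 §1.4, §2.3 (Laplacian / level projections); EscuderoGutierrez2023 (arXiv:2304.06713)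
Thm 1.6, Question 4.5; BarakHopkinsKelnerKothariMoitraPotechin2019 §2 (pseudo-expectations).
-/

-- D-0017: single-conjunct summit ⇒ the duplicate `QuantumAdvantage.QuantumAdvantage` is mandated.
set_option linter.dupNamespace false

noncomputable section

namespace Summit.QuantumAdvantage.QuantumAdvantage.Theorems.SosSandwich

open Finset MvPolynomial Literature.Computability.QuantumComplexity
open Literature.Computability.Complexity.LowDegree Literature.Probability.RandomGraphs.LowDegree

namespace TopLevelFourier

variable {N : ℕ}

/-! ### §1 The Laplacian eigen-equation in Fourier language -/

/-- `Σ_x f(x ⊕ e_i) χ_S(x) = ± Σ_x f(x) χ_S(x)` (sign `−` iff `i ∈ S`): change variables `x ↦ x ⊕ e_i`.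
[cite: ODonnell2014, §2.3] -/
theorem sum_flipBit_mul_walsh (f : (Fin N → Bool) → ℝ) (i : Fin N) (S : Finset (Fin N)) :
    ∑ x, f (flipBit i x) * walsh S x = (if i ∈ S then -1 else 1) * ∑ x, f x * walsh S x := by
  have h := sum_flipBit i (fun x => f x * walsh S (flipBit i x))
  simp only [flipBit_flipBit] at h
  rw [h, Finset.mul_sum]
  refine Finset.sum_congr rfl fun x _ => ?_
  rw [walsh_flipBit]
  ring

/-- **The Laplacian multiplies `χ_S` by `2|S|`**: the Fourier coefficient at `S` of
`x ↦ Σᵢ (f(x) − f(x ⊕ eᵢ))` is `2|S|·f̂(S)`. [cite: ODonnell2014, §2.3] -/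
theorem cubeFourierCoeff_laplacian (f : (Fin N → Bool) → ℝ) (S : Finset (Fin N)) :
    cubeFourierCoeff (fun x => ∑ i, (f x - f (flipBit i x))) S = 2 * (S.card : ℝ) * cubeFourierCoeff f S := by
  unfold cubeFourierCoeff
  rw [mul_div_assoc']
  congr 1
  have e1 : ∑ x : Fin N → Bool, (∑ i, (f x - f (flipBit i x))) * walsh S x =
      ∑ i : Fin N, ((∑ x : Fin N → Bool, f x * walsh S x) - ∑ x : Fin N → Bool, f (flipBit i x) * walsh S x) := by
    calc ∑ x : Fin N → Bool, (∑ i, (f x - f (flipBit i x))) * walsh S x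
        = ∑ x : Fin N → Bool, ∑ i, (f x - f (flipBit i x)) * walsh S x :=
          Finset.sum_congr rfl fun x _ => Finset.sum_mul _ _ _
      _ = ∑ i : Fin N, ∑ x : Fin N → Bool, (f x - f (flipBit i x)) * walsh S x := Finset.sum_comm
      _ = ∑ i : Fin N, ((∑ x : Fin N → Bool, f x * walsh S x) -
            ∑ x : Fin N → Bool, f (flipBit i x) * walsh S x) :=
          Finset.sum_congr rfl fun i _ => by
            rw [← Finset.sum_sub_distrib]
            exact Finset.sum_congr rfl fun x _ => by ring
  rw [e1]
  simp_rw [sum_flipBit_mul_walsh]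
  have e2 : ∀ i : Fin N, (∑ x : Fin N → Bool, f x * walsh S x) -
      (if i ∈ S then -1 else 1) * ∑ x : Fin N → Bool, f x * walsh S x =
        (if i ∈ S then (2 : ℝ) else 0) * ∑ x : Fin N → Bool, f x * walsh S x := fun i => by
    split_ifs <;> ring
  simp_rw [e2]
  rw [← Finset.sum_mul, Finset.sum_ite_mem, Finset.univ_inter, Finset.sum_const, nsmul_eq_mul]
  ring

/-- **Top-homogeneity in Fourier language.** If `p` satisfies the Laplacian eigen-equation of the route's
`HomogeneousPBAAT` (`Σᵢ (p(x) − p(x ⊕ eᵢ)) = 4T·(p(x) − E p)`), then `p̂(S) = 0` for every nonempty `S` with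
`|S| ≠ 2T`: the centred part of `p` lives on Walsh level exactly `2T`. [cite: ODonnell2014, §2.3]
[cite: EscuderoGutierrez2023, Thm 1.6] -/
theorem cubeFourierCoeff_eq_zero_of_laplacian (T : ℕ) (p : MvPolynomial (Fin N) ℝ)
    (hL : ∀ x : Fin N → Bool, ∑ i : Fin N, (evalBool p x - evalBool p (Function.update x i (!x i))) =
      4 * (T : ℝ) * (evalBool p x - boolAvg (evalBool p)))
    {S : Finset (Fin N)} (hS0 : S ≠ ∅) (hS : S.card ≠ 2 * T) :
    cubeFourierCoeff (evalBool p) S = 0 := by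
  have hfun : (fun x : Fin N → Bool => ∑ i : Fin N, (evalBool p x - evalBool p (flipBit i x))) =
      fun x => 4 * (T : ℝ) * (evalBool p x - boolAvg (evalBool p)) := funext fun x => hL x
  have h1 := cubeFourierCoeff_laplacian (evalBool p) S
  rw [hfun, cubeFourierCoeff_const_mul, cubeFourierCoeff_sub, cubeFourierCoeff_const hS0, sub_zero] at h1
  -- `(4T − 2|S|)·p̂(S) = 0`
  have h2 : (4 * (T : ℝ) - 2 * (S.card : ℝ)) * cubeFourierCoeff (evalBool p) S = 0 := by linarith
  rcases mul_eq_zero.mp h2 with h3 | h3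
  · exfalso
    apply hS
    have : (S.card : ℝ) = 2 * (T : ℝ) := by linarith
    exact_mod_cast this
  · exact h3

/-- The centred part `h = p − E p` of a top-homogeneous `p`: `ĥ(S) = 0` unless `|S| = 2T` (for `S = ∅`,
`ĥ(∅) = E h = 0`). [cite: ODonnell2014, §2.3] -/
theorem centred_coeff_eq_zero_of_laplacian (T : ℕ) (p : MvPolynomial (Fin N) ℝ)
    (hL : ∀ x : Fin N → Bool, ∑ i : Fin N, (evalBool p x - evalBool p (Function.update x i (!x i))) =
      4 * (T : ℝ) * (evalBool p x - boolAvg (evalBool p)))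
    {S : Finset (Fin N)} (hS : S.card ≠ 2 * T) :
    cubeFourierCoeff (fun x => evalBool p x - boolAvg (evalBool p)) S = 0 := by
  rw [cubeFourierCoeff_sub]
  by_cases hS0 : S = ∅
  · subst hS0
    rw [cubeFourierCoeff_empty, cubeFourierCoeff_empty]
    unfold boolAvg
    rw [Finset.sum_const, Finset.card_univ, Fintype.card_fun, Fintype.card_bool, Fintype.card_fin,
      nsmul_eq_mul]
    push_cast
    field_simp
    ring
  · rw [cubeFourierCoeff_eq_zero_of_laplacian T p hL hS0 hS, cubeFourierCoeff_const hS0, sub_zero]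

/-! ### §2 The homogeneous multiplier reduction -/

/-- Plancherel in the form `E[f g] = Σ_S f̂(S) ĝ(S)`. [cite: ODonnell2014, §1.4] -/
theorem boolAvg_mul_eq_sum_coeff (f g : (Fin N → Bool) → ℝ) :
    boolAvg (fun x => f x * g x) = ∑ S, cubeFourierCoeff f S * cubeFourierCoeff g S := by
  have h := cubeFourierCoeff_mul f g ∅
  rw [cubeFourierCoeff_empty] at h
  have e : ∀ S : Finset (Fin N), symmDiff S ∅ = S := fun S => symmDiff_bot S
  simp_rw [e] at h
  exact h

/-- The top (`|S| = T`) and low (`|S| < T`) Walsh parts of a degree-`≤ T` polynomial `q`: on the cube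
`q = a + b`, with prescribed coefficients. [cite: ODonnell2014, §1.4] -/
theorem evalBool_eq_top_add_low {T : ℕ} {q : MvPolynomial (Fin N) ℝ} (hq : q.totalDegree ≤ T)
    (x : Fin N → Bool) :
    evalBool q x =
      (∑ S, (if S.card = T then cubeFourierCoeff (evalBool q) S else 0) * walsh S x) +
        ∑ S, (if S.card < T then cubeFourierCoeff (evalBool q) S else 0) * walsh S x := by
  rw [← sum_cubeFourierCoeff_mul_walsh (evalBool q) x, ← Finset.sum_add_distrib]
  refine Finset.sum_congr rfl fun S _ => ?_
  rcases Nat.lt_trichotomy S.card T with h | h | h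
  · rw [if_neg (by omega), if_pos h]; ring
  · rw [if_pos h, if_neg (by omega)]; ring
  · rw [if_neg (by omega), if_neg (by omega), cubeFourierCoeff_evalBool_eq_zero hq h]; ring

/-- **`E[q² h] = E[a² h]`** when `h` lives on level `2T` and `q` has degree `≤ T`, `a` = top Walsh part of
`q`: the difference `q² − a² = b(2a + b)` has Fourier degree `≤ 2T − 1`. [cite: ODonnell2014, §1.4] -/
theorem boolAvg_sq_mul_eq_top {T : ℕ} (hT : 1 ≤ T) {q : MvPolynomial (Fin N) ℝ} (hq : q.totalDegree ≤ T)
    (h : (Fin N → Bool) → ℝ) (hh : ∀ S : Finset (Fin N), S.card ≠ 2 * T → cubeFourierCoeff h S = 0) :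
    boolAvg (fun x => evalBool q x ^ 2 * h x) =
      boolAvg (fun x => (∑ S, (if S.card = T then cubeFourierCoeff (evalBool q) S else 0) * walsh S x) ^ 2 * h x) := by
  set cT : Finset (Fin N) → ℝ := fun S => if S.card = T then cubeFourierCoeff (evalBool q) S else 0 with hcT
  set cL : Finset (Fin N) → ℝ := fun S => if S.card < T then cubeFourierCoeff (evalBool q) S else 0 with hcL
  set a : (Fin N → Bool) → ℝ := fun x => ∑ S, cT S * walsh S x with ha
  set b : (Fin N → Bool) → ℝ := fun x => ∑ S, cL S * walsh S x with hb
  have hqab : ∀ x, evalBool q x = a x + b x := fun x => evalBool_eq_top_add_low hq x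
  -- Fourier degrees: `a` ≤ T, `b` ≤ T − 1
  have ha_lvl : IsLevelLE T a := by
    intro S hS
    rw [ha, cubeFourierCoeff_sum_mul_walsh, hcT]
    simp only
    rw [if_neg (by omega)]
  have hb_lvl : IsLevelLE (T - 1) b := by
    intro S hS
    rw [hb, cubeFourierCoeff_sum_mul_walsh, hcL]
    simp only
    rw [if_neg (by omega)]
  -- `r = q² − a² = b·(2a + b)` has degree ≤ 2T − 1
  have h2ab_lvl : IsLevelLE T (fun x => 2 * a x + b x) :=
    (ha_lvl.const_mul 2).add (hb_lvl.mono (by omega))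
  have hr_lvl : IsLevelLE (T - 1 + T) (fun x => b x * (2 * a x + b x)) := hb_lvl.mul h2ab_lvl
  have hr : ∀ x, evalBool q x ^ 2 * h x = a x ^ 2 * h x + (b x * (2 * a x + b x)) * h x := fun x => by
    rw [hqab x]; ring
  have hsplit : boolAvg (fun x => evalBool q x ^ 2 * h x) =
      boolAvg (fun x => a x ^ 2 * h x) + boolAvg (fun x => (b x * (2 * a x + b x)) * h x) := by
    rw [show (fun x => evalBool q x ^ 2 * h x) = fun x => a x ^ 2 * h x + (b x * (2 * a x + b x)) * h x
      from funext hr]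
    unfold boolAvg
    rw [Finset.sum_add_distrib, add_div]
  have hzero : boolAvg (fun x => (b x * (2 * a x + b x)) * h x) = 0 := by
    rw [boolAvg_mul_eq_sum_coeff]
    refine Finset.sum_eq_zero fun S _ => ?_
    by_cases hS : S.card = 2 * T
    · rw [hr_lvl S (by omega), zero_mul]
    · rw [hh S hS, mul_zero]
  rw [hsplit, hzero, add_zero]

/-- **`E[a²] ≤ E[q²]`** for the top Walsh part `a` of `q` (Parseval). [cite: ODonnell2014, §1.4] -/
theorem boolAvg_top_sq_le (T : ℕ) (q : MvPolynomial (Fin N) ℝ) :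
    boolAvg (fun x => (∑ S, (if S.card = T then cubeFourierCoeff (evalBool q) S else 0) * walsh S x) ^ 2) ≤
      boolAvg (fun x => evalBool q x ^ 2) := by
  have h2 : (0 : ℝ) < 2 ^ N := by positivity
  unfold boolAvg
  rw [sum_sq_sum_mul_walsh, mul_div_cancel_left₀ _ h2.ne']
  have hP := sum_cubeFourierCoeff_sq (evalBool q)
  rw [← hP]
  refine Finset.sum_le_sum fun S _ => ?_
  split_ifs
  · exact le_rfl
  · rw [zero_pow two_ne_zero]; exact sq_nonneg _

end TopLevelFourier

open TopLevelFourier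

variable {N : ℕ}

/-- **Variance of a top-homogeneous `p ∈ K_T` from the HOMOGENEOUS multiplier norm of its centred part.**
If `p ∈ K_T` satisfies the Laplacian eigen-equation of `HomogeneousPBAAT` (centred part on level `2T`) and
`|E[a²·(p − E p)]| ≤ κ·E[a²]` for every homogeneous level-`T` Walsh sum `a = Σ_S c_S χ_S` (coefficients `c`
supported on `|S| = T`), then `Var[p] ≤ κ · min(E p, 1 − E p)` (`≤ κ/2`).  Proof: for a general degree-`≤ T`
test polynomial `q` only its top Walsh part sees `p − E p` (`boolAvg_sq_mul_eq_top`, `boolAvg_top_sq_le`),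
then `boolVariance_le_of_multiplier`.  Calibration/caveat: `κ` is NOT bounded by `C√(T·maxInf)` in general
(symmetric quadratics at `T = 1`, module docstring), so this lemma alone does not give the rung.
[cite: EscuderoGutierrez2023, Question 4.5]
[cite: BarakHopkinsKelnerKothariMoitraPotechin2019, §2 (pseudo-expectations)] -/
theorem boolVariance_le_of_homogeneous_multiplier {T : ℕ} (hT : 1 ≤ T) {p : MvPolynomial (Fin N) ℝ}
    (hp : PseudoBounded T p)
    (hL : ∀ x : Fin N → Bool, ∑ i : Fin N, (evalBool p x - evalBool p (Function.update x i (!x i))) =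
      4 * (T : ℝ) * (evalBool p x - boolAvg (evalBool p)))
    {κ : ℝ} (hκ0 : 0 ≤ κ)
    (hκ : ∀ c : Finset (Fin N) → ℝ, (∀ S, S.card ≠ T → c S = 0) →
      |boolAvg (fun x => (∑ S, c S * walsh S x) ^ 2 * (evalBool p x - boolAvg (evalBool p)))| ≤
        κ * boolAvg (fun x => (∑ S, c S * walsh S x) ^ 2)) :
    boolVariance p ≤ κ * min (boolAvg (evalBool p)) (1 - boolAvg (evalBool p)) := by
  refine boolVariance_le_of_multiplier hp fun q hq => ?_
  set h : (Fin N → Bool) → ℝ := fun x => evalBool p x - boolAvg (evalBool p) with hh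
  have hhS : ∀ S : Finset (Fin N), S.card ≠ 2 * T → cubeFourierCoeff h S = 0 :=
    fun S hS => centred_coeff_eq_zero_of_laplacian T p hL hS
  set cT : Finset (Fin N) → ℝ := fun S => if S.card = T then cubeFourierCoeff (evalBool q) S else 0 with hcT
  have hcT0 : ∀ S, S.card ≠ T → cT S = 0 := fun S hS => by rw [hcT]; simp only; rw [if_neg hS]
  have e1 : boolAvg (fun x => evalBool q x ^ 2 * h x) = boolAvg (fun x => (∑ S, cT S * walsh S x) ^ 2 * h x) :=
    boolAvg_sq_mul_eq_top hT hq h hhS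
  have e2 : boolAvg (fun x => (∑ S, cT S * walsh S x) ^ 2) ≤ boolAvg (fun x => evalBool q x ^ 2) :=
    boolAvg_top_sq_le T q
  calc |boolAvg (fun x => evalBool q x ^ 2 * h x)|
      = |boolAvg (fun x => (∑ S, cT S * walsh S x) ^ 2 * h x)| := by rw [e1]
    _ ≤ κ * boolAvg (fun x => (∑ S, cT S * walsh S x) ^ 2) := hκ cT hcT0
    _ ≤ κ * boolAvg (fun x => evalBool q x ^ 2) := mul_le_mul_of_nonneg_left e2 hκ0

/-! ### §4 The Boolean sub-corner of the top-homogeneous class: constant sensitivity -/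

/-- **Rigidity of Boolean-valued top-homogeneous `p`.**  If `p` is `{0,1}`-valued on the cube and satisfies the
Laplacian eigen-equation of `HomogeneousPBAAT` with parameter `T`, then at EVERY point `x` the number of
sensitive coordinates (those `i` with `p(x ⊕ eᵢ) ≠ p(x)`) is exactly `4T·|p(x) − E p|` — i.e. `4T(1 − E p)` on
`p = 1` and `4T·E p` on `p = 0` (each difference `p(x) − p(x ⊕ eᵢ)` is `0` or has the sign of `p(x) − 1/2`).
In particular `4T·E p` and `4T·(1 − E p)` are natural numbers as soon as both values occur, and the XOR-square /
address families of `not_HomogeneousPBAA` (`E p = 1/2`) have sensitivity `2T = deg` at every point.  A handle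
for refuters of the Boolean sub-corner of 27399 (where the law `maxInf ≥ C·Var²/T` reads: some coordinate is
sensitive on a `≥ C'·E p²(1−E p)²/T` fraction of the cube).  [cite: ODonnell2014, §2.3] -/
theorem card_sensitive_eq_of_laplacian_boolean (T : ℕ) (p : MvPolynomial (Fin N) ℝ)
    (hB : ∀ x : Fin N → Bool, evalBool p x = 0 ∨ evalBool p x = 1)
    (hL : ∀ x : Fin N → Bool, ∑ i : Fin N, (evalBool p x - evalBool p (Function.update x i (!x i))) =
      4 * (T : ℝ) * (evalBool p x - boolAvg (evalBool p)))
    (x : Fin N → Bool) :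
    ((Finset.univ.filter fun i : Fin N => evalBool p (flipBit i x) ≠ evalBool p x).card : ℝ) =
      4 * (T : ℝ) * |evalBool p x - boolAvg (evalBool p)| := by
  have hLx := hL x
  rcases hB x with h0 | h1
  · -- `p(x) = 0`: every difference is `0` or `−1`
    have hterm : ∀ i : Fin N, evalBool p x - evalBool p (flipBit i x) =
        -(if evalBool p (flipBit i x) ≠ evalBool p x then (1 : ℝ) else 0) := fun i => by
      rcases hB (flipBit i x) with g0 | g1
      · rw [g0, h0]; simp
      · rw [g1, h0]; norm_num
    have hsum : ∑ i : Fin N, (evalBool p x - evalBool p (Function.update x i (!x i))) =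
        -(((Finset.univ.filter fun i : Fin N => evalBool p (flipBit i x) ≠ evalBool p x).card : ℝ)) := by
      rw [Finset.natCast_card_filter, ← Finset.sum_neg_distrib]
      exact Finset.sum_congr rfl fun i _ => hterm i
    rw [hsum, h0, zero_sub] at hLx
    have hμ : 0 ≤ boolAvg (evalBool p) :=
      boolAvg_nonneg fun y => by rcases hB y with g | g <;> norm_num [g]
    rw [h0, zero_sub, abs_neg, abs_of_nonneg hμ]
    linarith
  · -- `p(x) = 1`: every difference is `0` or `1`
    have hterm : ∀ i : Fin N, evalBool p x - evalBool p (flipBit i x) =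
        (if evalBool p (flipBit i x) ≠ evalBool p x then (1 : ℝ) else 0) := fun i => by
      rcases hB (flipBit i x) with g0 | g1
      · rw [g0, h1]; norm_num
      · rw [g1, h1]; simp
    have hsum : ∑ i : Fin N, (evalBool p x - evalBool p (Function.update x i (!x i))) =
        ((Finset.univ.filter fun i : Fin N => evalBool p (flipBit i x) ≠ evalBool p x).card : ℝ) := by
      rw [Finset.natCast_card_filter]
      exact Finset.sum_congr rfl fun i _ => hterm i
    rw [hsum, h1] at hLx
    have hμ : boolAvg (evalBool p) ≤ 1 := by
      have : boolAvg (evalBool p) ≤ boolAvg (fun _ : Fin N → Bool => (1 : ℝ)) := by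
        unfold boolAvg
        gcongr with y
        rcases hB y with g | g <;> norm_num [g]
      simpa using this
    rw [h1, abs_of_nonneg (by linarith)]
    exact hLx

end Summit.QuantumAdvantage.QuantumAdvantage.Theorems.SosSandwich

end
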